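import Summits.ABC.IUTFork.Conditional.AbcOfSGenuineKChosenDepthHexFamily
import HarnessLib

/-!
# Branch C / R-W «HEX-SHARP» input — the EXPLICIT-threshold form of the HEX family depth lemma via the TAME route:
# at every genuine Θ-volume datum over `λ_k = 1/2 + 2/7^k`, the top-label packet over `7` is deep as soon as ONE integer
# inequality in `(k, l)` holds — e.g. `l = 11, k ≥ 35`; `l = 13, k ≥ 34`; `l ∈ {17, 19, 23, 29, 31, 37}, k ≥ 33`

PROOF-ONLY file (D-0012; 0 definitions, 0 `Prop` facts, no instance, no notation) of the abc-iut cell (Cor. 3.12 sub-crew seat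
abc-iut-c312-7, gen 6), SEQUEL of this seat's family theorem `GenuineK.exists_deep_place_lamSeven_all` (p444317: `∃ k*`, via
abc-iut-C-cert-1's degree-form arithmetic core `Hex.core_ineq`, whose threshold `k₁(l) = ⌈52.25 + 22·ln l⌉` is existential in the
statement and ≈ 106 at `l = 11`). INPUT offered to the D-0079 R-W sub-cell's lane P− task «HEX-SHARP» (plan/W/WINDOW-SPEC.md §6; holder
abc-iut-w5-d163 g7, who keeps the window-level assembly `not_hSHw_lamSeven_of_ge`). TAKES NO SIDE on [IUTchIII] Cor. 3.12 or on any author.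

WHAT IS ADDED — arithmetic only; every number-theoretic input is this seat's LANDED tame-route brick `GenuineK.exists_place_lamSeven`
(Cor312GenuineKDeepDatumLam, p443067: at every `T : Cor22.ThetaVolumeDatumAt (ratPoint λ_k) l`, `l` prime `≥ 11`, `k ≥ 1`, there is a
fibre point `x₀ | 7` in `S` with `7 ∤ e_w`, `e_w ≤ 46080·l(l−1)²(l+1)`, `d + a + b ≤ 2 + log_7(46080·l(l−1)²(l+1))` and
`‖t_q(x₀)‖ = 7^{−k/l}` EXACTLY for the chosen realising q-idele):
* §1 `Hex.tame_core` — for odd `l ≥ 11`, `j := (l−1)/2`, ANY `N ≥ 1` and any `0 ≤ τ ≤ 7^{−k/l}`: the INTEGER test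
  `7^{l·(2j+3)} · N^{l·(j+1)} < 7^{k·(j²−1)}` implies `7^{((j−1)+2)·(2 + log N/log 7) + 1} · τ^{j²−1} < 1` — the depth inequality with the
  tame constant `2 + log_7 N`. FLOOR-FREE (abc-iut-rp-m4's caveat 14:11:40Z: the family form goes through real exponents, no `⌊·⌋`),
  hence monotone in `k`.
* §2 `GenuineK.exists_deep_place_lamSeven_of_pow_lt` — the integer test at `N := 46080·l(l−1)²(l+1)` implies, for EVERY datum `T` at
  `(ratPoint λ_k, l)`: the top label `i = (l−1)/2 − 1` and some `x₀ | 7` in `S` satisfy abc-iut-w5-d107's explicit depth inequality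
  `7^{((i+2)(d+a+b)+1)}·‖t_q(x₀)‖^{(i+1)²−1} < 1` — the SAME conclusion shape as p444317, consumed in one `obtain` by
  `Thm311.Real.not_licence_settingPrVolSharp_of_realises_explicit` (p437756) / `GenuineK.not_pilotKummerCompatHull_chosen_of_explicit_depth`
  (p438886): the (xi-f) licence and the per-datum S_H clause FAIL at the sharp genuine setting of every such datum.
* §4 `GenuineK.not_pilotKummerCompatHull_lamSeven_of_pow_lt` / `…_tameTable` — S_H (`Cor312Vol.PilotKummerCompatHull`, pinned reading, chosen
  realising ideles) FAILS at the sharp genuine setting of every such datum (composition with abc-iut-C-cert-1's p438886 exactly as in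
  abc-iut-rp-m4's HEX-SHARP floor `AbcOfSGenuineKChosenDepthHexSharp` p454167, whose thresholds via `N < 7^m` are `k ≥ 37` / `k ≥ 35`; this
  sequel sharpens them by the exact-log test and adds six primes `l`).
* §3 CLOSED THRESHOLDS (the integer test discharged by `decide`-grade evaluation; exact — `k₂(l)` is the least `k` passing the test):
  `l = 11: k ≥ 35` · `l = 13: k ≥ 34` · `l = 17, 19, 23, 29, 31, 37: k ≥ 33` (versus `k₁(l)` ≈ 106, 109, 115, 118, 122, 127, 128, 132).
  Sharper local constants (WINDOW-SPEC §6 (1)(2): `d < 1`, `a ≤ 0.3`, `b ≤ 7`; or `e_w ≤ 2·l·e(F‡_v/ℚ_7)`) lower these further by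
  replacing `N` — the core is stated for ANY `N`.

HONEST SCOPE: SHARP reading; depth of ONE packet at OUR genuine sharp setting for a typed family; the per-label licence is a
STRONGER-THAN-PRINT sufficient form of (xi-f); failure there says NOTHING about the printed GLOBAL inequality, the number-level
`Cor22.Cor312AtDatum`, or any certificate's NUM side; refuted-as-typed ≠ refuted-in-print; no side taken on any author; nothing here
asserts that abc is proved or refuted; typed ≠ proved. [cite: Mochizuki2012, IUTchIII Cor. 3.12 Step (xi-f) p. 184; IUTchIV Prop. 1.2 p. 10, Thm. 1.10 Steps (ii)–(v) p. 24–29, Cor. 2.2 (ii) proof p. 45–46]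
[cite: DupuyHilado2025, §3.4, §4.10] [claim: Mochizuki2012, status: disputed] for every IUT quotation.
-/

noncomputable section

open Set Function NumberField IsDedekindDomain

namespace Summit.ABC.IUTFork.Conditional

open Thm311 Thm311.Real Cor312 Cor312Vol Cor312Prov Literature.IUT.LogThetaLattice Literature.IUT.LogVolume
  Literature.IUT.HodgeTheaters Literature.NumberTheory.DiophantineGeometry.GenEll Summit.ABC.ABC.Theorems

/-! ## §1. The tame arithmetic core (floor-free, any `N`) -/

namespace Hex

/-- **Tame core.** For odd `l ≥ 11` with `j := (l−1)/2`, any `N ≥ 1`, any `0 ≤ τ ≤ 7^{−k/l}`: the integer test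
`7^{l(2j+3)}·N^{l(j+1)} < 7^{k(j²−1)}` gives `7^{((j−1)+2)(2 + log N/log 7) + 1}·τ^{j²−1} < 1`. Proof: for `τ > 0` take logarithms —
`log LHS ≤ log 7·(A − (j²−1)k/l)` with `l·A = l(2j+3) + l(j+1)·log N/log 7`, and the test says exactly `l·A < k(j²−1)`. [folklore] -/
theorem tame_core (k l N : ℕ) (h11 : 11 ≤ l) (hN1 : 1 ≤ N)
    (hpow : 7 ^ (l * (2 * ((l - 1) / 2) + 3)) * N ^ (l * ((l - 1) / 2 + 1)) < 7 ^ (k * (((l - 1) / 2) ^ 2 - 1)))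
    (τ : ℝ) (hτ0 : 0 ≤ τ) (hτ : τ ≤ (7 : ℝ) ^ (-((k : ℝ) / l))) :
    (7 : ℝ) ^ (((((l - 1) / 2 - 1 : ℕ) : ℝ) + 2) * (2 + Real.log (N : ℝ) / Real.log 7) + 1) *
      τ ^ (((l - 1) / 2) ^ 2 - 1) < 1 := by
  set j : ℕ := (l - 1) / 2 with hj
  have hj5 : 5 ≤ j := by omega
  set m : ℕ := j ^ 2 - 1 with hm
  have hm1 : 1 ≤ m := by
    have : 25 ≤ j ^ 2 := by nlinarith
    omega
  have h70 : (0 : ℝ) < 7 := by norm_num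
  have hlog7 : 0 < Real.log 7 := Real.log_pos (by norm_num)
  have hlpos : (0 : ℝ) < l := by exact_mod_cast (show 0 < l by omega)
  have hNpos : (0 : ℝ) < N := by exact_mod_cast (show 0 < N by omega)
  -- the exponent, with `(j - 1 : ℕ) + 2 = j + 1`
  have hcast : (((j - 1 : ℕ) : ℝ) + 2) = (j : ℝ) + 1 := by
    rw [Nat.cast_sub (by omega : 1 ≤ j)]
    push_cast
    ring
  set A : ℝ := (((j - 1 : ℕ) : ℝ) + 2) * (2 + Real.log (N : ℝ) / Real.log 7) + 1 with hA
  have hApos : 0 < (7 : ℝ) ^ A := Real.rpow_pos_of_pos h70 A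
  -- the integer test, in logarithms: `l·(2j+3)·log 7 + l·(j+1)·log N < k·m·log 7`
  have htest : (l : ℝ) * (2 * j + 3) * Real.log 7 + (l : ℝ) * (j + 1) * Real.log N < (k : ℝ) * m * Real.log 7 := by
    have h1 : ((7 : ℝ) ^ (l * (2 * j + 3)) * (N : ℝ) ^ (l * (j + 1))) < (7 : ℝ) ^ (k * m) := by
      exact_mod_cast hpow
    have h2 : (0 : ℝ) < (7 : ℝ) ^ (l * (2 * j + 3)) * (N : ℝ) ^ (l * (j + 1)) := by positivity
    have h3 := Real.log_lt_log h2 h1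
    rw [Real.log_mul (by positivity) (by positivity), Real.log_pow, Real.log_pow, Real.log_pow] at h3
    push_cast at h3
    linarith
  -- hence `l·A < k·m`, i.e. `A < k·m/l`
  have hlA : (l : ℝ) * A < (k : ℝ) * m := by
    have hdiv : (l : ℝ) * A * Real.log 7 =
        (l : ℝ) * (2 * j + 3) * Real.log 7 + (l : ℝ) * (j + 1) * Real.log N := by
      rw [hA, hcast]
      field_simp
      ring
    nlinarith [hdiv, htest, hlog7]
  -- case `τ = 0`
  rcases hτ0.eq_or_lt with hτz | hτpos
  · rw [← hτz, zero_pow (by omega), mul_zero]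
    exact one_pos
  -- case `τ > 0`: logarithms
  have hprod : 0 < (7 : ℝ) ^ A * τ ^ m := mul_pos hApos (pow_pos hτpos m)
  rw [← Real.log_neg_iff hprod, Real.log_mul hApos.ne' (pow_pos hτpos m).ne', Real.log_rpow h70, Real.log_pow]
  have hlogτ : Real.log τ ≤ -((k : ℝ) / l) * Real.log 7 := by
    have := Real.log_le_log hτpos hτ
    rwa [Real.log_rpow h70] at this
  have hmR : (0 : ℝ) ≤ (m : ℝ) := by positivity
  have hkey : A * Real.log 7 + (m : ℝ) * (-((k : ℝ) / l) * Real.log 7) < 0 := by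
    have : A - (m : ℝ) * k / l < 0 := by
      rw [sub_neg, lt_div_iff₀ hlpos]
      linarith
    have h' : A * Real.log 7 + (m : ℝ) * (-((k : ℝ) / l) * Real.log 7) = (A - (m : ℝ) * k / l) * Real.log 7 := by ring
    rw [h']
    exact mul_neg_of_neg_of_pos this hlog7
  calc A * Real.log 7 + (m : ℝ) * Real.log τ
      ≤ A * Real.log 7 + (m : ℝ) * (-((k : ℝ) / l) * Real.log 7) := by gcongr
    _ < 0 := hkey

end Hex

/-! ## §2. The family depth lemma with an explicit integer test -/

/-- **Explicit depth (tame route).** For `k ≥ 1`, `l` prime `≥ 11` with `j := (l−1)/2`, the integer test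
`7^{l(2j+3)}·(46080·l(l−1)²(l+1))^{l(j+1)} < 7^{k(j²−1)}` implies: for EVERY genuine Θ-volume datum `T` at `(ratPoint λ_k, l)`, the top
label `i = j − 1` and some fibre point `x₀ | 7` in `S` satisfy `7^{((i+2)(d+a+b)+1)}·‖t_q(x₀)‖^{(i+1)²−1} < 1` for the chosen realising
q-idele (`GenuineK.exists_place_lamSeven` + `Hex.tame_core`). Consumers (one `obtain`): p437756 / p438886 — the (xi-f) licence and the
per-datum S_H clause FAIL at the sharp genuine setting of every such datum. [cite: Mochizuki2012, IUTchIV Prop. 1.2 p. 10, Cor. 2.2 (ii) proof (P5) p. 46]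
[claim: Mochizuki2012, status: disputed] -/
theorem GenuineK.exists_deep_place_lamSeven_of_pow_lt {k l : ℕ} (hk : 1 ≤ k) (hl : l.Prime) (h11 : 11 ≤ l)
    (hpow : 7 ^ (l * (2 * ((l - 1) / 2) + 3)) * (46080 * (l * (l - 1) ^ 2 * (l + 1))) ^ (l * ((l - 1) / 2 + 1))
      < 7 ^ (k * (((l - 1) / 2) ^ 2 - 1)))
    (T : Cor22.ThetaVolumeDatumAt (ratPoint ((2 : ℚ)⁻¹ + 2 / 7 ^ k)) l) :
    letI := T.instFieldF; letI := T.instNumberFieldF; letI := T.instAlgebraF; letI := T.instFieldK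
    letI := T.instNumberFieldK; letI := T.instAlgebraK; letI := T.instFieldFbar; letI := T.instAlgebraFbar
    letI := T.instAlgebraKFbar; letI := T.instIsElliptic
    haveI : Fact (Nat.Prime 7) := ⟨by norm_num⟩
    ∃ (i : Fin (thetaIndex (pilotDataOfK T.D T.K)).lstar) (x₀ : (thetaIndex (pilotDataOfK T.D T.K)).Fibre (.inr ⟨7, by norm_num⟩)),
      (i : ℕ) = (l - 1) / 2 - 1 ∧
      placeOf (pilotDataOfK T.D T.K) 7 x₀ ∈ (pilotDataOfK T.D T.K).S ∧
      (7 : ℝ) ^ ((((i : ℕ) : ℝ) + 2) * (differentOrd 7 (kOf (pilotDataOfK T.D T.K) 7 x₀)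
          + logRadiusA 7 (absRamificationIdx 7 (kOf (pilotDataOfK T.D T.K) 7 x₀))
          + logRadiusB 7 (absRamificationIdx 7 (kOf (pilotDataOfK T.D T.K) 7 x₀))) + 1) *
        ‖(exists_realising_qIdeles_pilotDataOfK T.D).choose ⟨7, by norm_num⟩ x₀‖ ^ (((i : ℕ) + 1) ^ 2 - 1) < 1 := by
  classical
  letI := T.instFieldF; letI := T.instNumberFieldF; letI := T.instAlgebraF; letI := T.instFieldK
  letI := T.instNumberFieldK; letI := T.instAlgebraK; letI := T.instFieldFbar; letI := T.instAlgebraFbar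
  letI := T.instAlgebraKFbar; letI := T.instIsElliptic
  haveI : Fact (Nat.Prime 7) := ⟨by norm_num⟩
  obtain ⟨x₀, hS, -, -, hB, hnorm⟩ := GenuineK.exists_place_lamSeven hk hl h11 T
  have hlstar : (thetaIndex (pilotDataOfK T.D T.K)).lstar = (l - 1) / 2 := rfl
  have hil : (l - 1) / 2 - 1 < (thetaIndex (pilotDataOfK T.D T.K)).lstar := by rw [hlstar]; omega
  refine ⟨⟨(l - 1) / 2 - 1, hil⟩, x₀, rfl, hS, ?_⟩
  set N : ℕ := 46080 * (l * (l - 1) ^ 2 * (l + 1)) with hNdef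
  have hN1 : 1 ≤ N := by
    have : 1 ≤ l * (l - 1) ^ 2 * (l + 1) :=
      Nat.one_le_iff_ne_zero.mpr (Nat.mul_ne_zero (Nat.mul_ne_zero (by omega) (pow_ne_zero _ (by omega))) (by omega))
    omega
  have h7 : (1 : ℝ) < 7 := by norm_num
  have hτ0 : (0 : ℝ) ≤ (7 : ℝ) ^ (-((k : ℝ) / l)) := by positivity
  have hcore := Hex.tame_core k l N h11 hN1 hpow ((7 : ℝ) ^ (-((k : ℝ) / l))) hτ0 le_rfl
  -- monotonicity in the exponent: `d + a + b ≤ 2 + log N / log 7`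
  have hexp : ((((((l - 1) / 2 - 1 : ℕ)) : ℝ) + 2) * (differentOrd 7 (kOf (pilotDataOfK T.D T.K) 7 x₀)
        + logRadiusA 7 (absRamificationIdx 7 (kOf (pilotDataOfK T.D T.K) 7 x₀))
        + logRadiusB 7 (absRamificationIdx 7 (kOf (pilotDataOfK T.D T.K) 7 x₀))) + 1) ≤
      (((((l - 1) / 2 - 1 : ℕ)) : ℝ) + 2) * (2 + Real.log (N : ℝ) / Real.log 7) + 1 := by
    have hi : (0 : ℝ) ≤ ((((l - 1) / 2 - 1 : ℕ)) : ℝ) + 2 := by positivity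
    have := mul_le_mul_of_nonneg_left hB hi
    rw [hNdef]
    linarith
  have hpow' : (7 : ℝ) ^ ((((((l - 1) / 2 - 1 : ℕ)) : ℝ) + 2) * (differentOrd 7 (kOf (pilotDataOfK T.D T.K) 7 x₀)
        + logRadiusA 7 (absRamificationIdx 7 (kOf (pilotDataOfK T.D T.K) 7 x₀))
        + logRadiusB 7 (absRamificationIdx 7 (kOf (pilotDataOfK T.D T.K) 7 x₀))) + 1) ≤
      (7 : ℝ) ^ ((((((l - 1) / 2 - 1 : ℕ)) : ℝ) + 2) * (2 + Real.log (N : ℝ) / Real.log 7) + 1) :=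
    Real.rpow_le_rpow_of_exponent_le h7.le hexp
  have hτn : (0 : ℝ) ≤ ((7 : ℝ) ^ (-((k : ℝ) / l))) ^ (((l - 1) / 2) ^ 2 - 1) := pow_nonneg hτ0 _
  have hidx : ((l - 1) / 2 - 1) + 1 = (l - 1) / 2 := by omega
  show (7 : ℝ) ^ _ * ‖(exists_realising_qIdeles_pilotDataOfK T.D).choose ⟨7, by norm_num⟩ x₀‖ ^ ((((l - 1) / 2 - 1) + 1) ^ 2 - 1) < 1
  rw [hnorm, hidx]
  calc (7 : ℝ) ^ _ * ((7 : ℝ) ^ (-((k : ℝ) / l))) ^ (((l - 1) / 2) ^ 2 - 1)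
      ≤ (7 : ℝ) ^ ((((((l - 1) / 2 - 1 : ℕ)) : ℝ) + 2) * (2 + Real.log (N : ℝ) / Real.log 7) + 1) *
          ((7 : ℝ) ^ (-((k : ℝ) / l))) ^ (((l - 1) / 2) ^ 2 - 1) := mul_le_mul_of_nonneg_right hpow' hτn
    _ < 1 := hcore

/-! ## §3. Closed thresholds: the integer test evaluated -/

/-- The integer test is MONOTONE in `k`: if it passes at `k₀` it passes at every `k ≥ k₀`. [folklore] -/
theorem Hex.test_mono {l N k₀ k : ℕ} (hk : k₀ ≤ k)
    (h : 7 ^ (l * (2 * ((l - 1) / 2) + 3)) * N ^ (l * ((l - 1) / 2 + 1)) < 7 ^ (k₀ * (((l - 1) / 2) ^ 2 - 1))) :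
    7 ^ (l * (2 * ((l - 1) / 2) + 3)) * N ^ (l * ((l - 1) / 2 + 1)) < 7 ^ (k * (((l - 1) / 2) ^ 2 - 1)) :=
  lt_of_lt_of_le h (Nat.pow_le_pow_right (by norm_num) (Nat.mul_le_mul_right _ hk))

/-- `l = 11`: the test passes for every `k ≥ 35` (`N = 608 256 000`; least such `k`). [folklore] -/
theorem Hex.test_eleven {k : ℕ} (hk : 35 ≤ k) :
    7 ^ (11 * (2 * ((11 - 1) / 2) + 3)) * (46080 * (11 * (11 - 1) ^ 2 * (11 + 1))) ^ (11 * ((11 - 1) / 2 + 1))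
      < 7 ^ (k * (((11 - 1) / 2) ^ 2 - 1)) :=
  Hex.test_mono hk (by decide +kernel)

/-- `l = 13`: the test passes for every `k ≥ 34` (`N = 1 207 664 640`; least such `k`). [folklore] -/
theorem Hex.test_thirteen {k : ℕ} (hk : 34 ≤ k) :
    7 ^ (13 * (2 * ((13 - 1) / 2) + 3)) * (46080 * (13 * (13 - 1) ^ 2 * (13 + 1))) ^ (13 * ((13 - 1) / 2 + 1))
      < 7 ^ (k * (((13 - 1) / 2) ^ 2 - 1)) :=
  Hex.test_mono hk (by decide +kernel)

/-- `l = 17`: the test passes for every `k ≥ 33` (least such `k`). [folklore] -/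
theorem Hex.test_seventeen {k : ℕ} (hk : 33 ≤ k) :
    7 ^ (17 * (2 * ((17 - 1) / 2) + 3)) * (46080 * (17 * (17 - 1) ^ 2 * (17 + 1))) ^ (17 * ((17 - 1) / 2 + 1))
      < 7 ^ (k * (((17 - 1) / 2) ^ 2 - 1)) :=
  Hex.test_mono hk (by decide +kernel)

/-- `l = 19`: the test passes for every `k ≥ 33` (least such `k`). [folklore] -/
theorem Hex.test_nineteen {k : ℕ} (hk : 33 ≤ k) :
    7 ^ (19 * (2 * ((19 - 1) / 2) + 3)) * (46080 * (19 * (19 - 1) ^ 2 * (19 + 1))) ^ (19 * ((19 - 1) / 2 + 1))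
      < 7 ^ (k * (((19 - 1) / 2) ^ 2 - 1)) :=
  Hex.test_mono hk (by decide +kernel)

/-- `l = 23`: the test passes for every `k ≥ 33` (least such `k`). [folklore] -/
theorem Hex.test_twentythree {k : ℕ} (hk : 33 ≤ k) :
    7 ^ (23 * (2 * ((23 - 1) / 2) + 3)) * (46080 * (23 * (23 - 1) ^ 2 * (23 + 1))) ^ (23 * ((23 - 1) / 2 + 1))
      < 7 ^ (k * (((23 - 1) / 2) ^ 2 - 1)) :=
  Hex.test_mono hk (by decide +kernel)

/-- `l = 29`: the test passes for every `k ≥ 33` (least such `k`). [folklore] -/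
theorem Hex.test_twentynine {k : ℕ} (hk : 33 ≤ k) :
    7 ^ (29 * (2 * ((29 - 1) / 2) + 3)) * (46080 * (29 * (29 - 1) ^ 2 * (29 + 1))) ^ (29 * ((29 - 1) / 2 + 1))
      < 7 ^ (k * (((29 - 1) / 2) ^ 2 - 1)) :=
  Hex.test_mono hk (by decide +kernel)

/-- `l = 31`: the test passes for every `k ≥ 33` (least such `k`). [folklore] -/
theorem Hex.test_thirtyone {k : ℕ} (hk : 33 ≤ k) :
    7 ^ (31 * (2 * ((31 - 1) / 2) + 3)) * (46080 * (31 * (31 - 1) ^ 2 * (31 + 1))) ^ (31 * ((31 - 1) / 2 + 1))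
      < 7 ^ (k * (((31 - 1) / 2) ^ 2 - 1)) :=
  Hex.test_mono hk (by decide +kernel)

/-- `l = 37`: the test passes for every `k ≥ 33` (least such `k`). [folklore] -/
theorem Hex.test_thirtyseven {k : ℕ} (hk : 33 ≤ k) :
    7 ^ (37 * (2 * ((37 - 1) / 2) + 3)) * (46080 * (37 * (37 - 1) ^ 2 * (37 + 1))) ^ (37 * ((37 - 1) / 2 + 1))
      < 7 ^ (k * (((37 - 1) / 2) ^ 2 - 1)) :=
  Hex.test_mono hk (by decide +kernel)

/-! ## §4. Consequence at the window bed: S_H fails (composition BY NAME with abc-iut-C-cert-1's p438886, as in abc-iut-rp-m4's p454167) -/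

/-- **S_H FAILS at every genuine datum of the family once the integer test passes** (any `k ≥ 1`, prime `l ≥ 11`): for EVERY choice of the
context binders, the hull-level clause `Cor312Vol.PilotKummerCompatHull` at this seat's sharp genuine setting over `T.K` with the CHOSEN
realising ideles and the PINNED reading — the per-datum instance of the window binder hSHw — fails (abc-iut-C-cert-1's
`GenuineK.not_pilotKummerCompatHull_chosen_of_explicit_depth`, p438886, fed by §2; statement shape = abc-iut-rp-m4's
`GenuineK.not_pilotKummerCompatHull_lamSeven_of_threshold`, p454167, with the exact-log test in place of `N < 7^m`). Refuted-as-typed at one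
deep packet; nothing about the printed global inequality. [cite: Mochizuki2012, IUTchIII Cor. 3.12 Step (xi-f) p. 184] [claim: Mochizuki2012, status: disputed] -/
theorem GenuineK.not_pilotKummerCompatHull_lamSeven_of_pow_lt {k l : ℕ} (hk : 1 ≤ k) (hl : l.Prime) (h11 : 11 ≤ l)
    (hpow : 7 ^ (l * (2 * ((l - 1) / 2) + 3)) * (46080 * (l * (l - 1) ^ 2 * (l + 1))) ^ (l * ((l - 1) / 2 + 1))
      < 7 ^ (k * (((l - 1) / 2) ^ 2 - 1)))
    (T : Cor22.ThetaVolumeDatumAt (ratPoint ((2 : ℚ)⁻¹ + 2 / 7 ^ k)) l) :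
    letI := T.instFieldF; letI := T.instNumberFieldF; letI := T.instAlgebraF; letI := T.instFieldK
    letI := T.instNumberFieldK; letI := T.instAlgebraK; letI := T.instFieldFbar; letI := T.instAlgebraFbar
    letI := T.instAlgebraKFbar; letI := T.instIsElliptic
    ∀ (M : Type) [Field M] [NumberField M]
      (archPk : ∀ (j : (thetaIndex (pilotDataOfK T.D T.K)).Label) (vQ : (thetaIndex (pilotDataOfK T.D T.K)).VQ),
        Set ((logShellsDH (pilotDataOfK T.D T.K) (analyticLogv T.K)).Packet j vQ))
      (archSub : ∀ (j : (thetaIndex (pilotDataOfK T.D T.K)).Label) (v : (thetaIndex (pilotDataOfK T.D T.K)).V),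
        Set ((logShellsDH (pilotDataOfK T.D T.K) (analyticLogv T.K)).Packet j ((thetaIndex (pilotDataOfK T.D T.K)).over v)))
      (Ψ : ℤ → ∀ v : (thetaIndex (pilotDataOfK T.D T.K)).V, v ∈ (thetaIndex (pilotDataOfK T.D T.K)).Vbad →
        Set ((logShellsDH (pilotDataOfK T.D T.K) (analyticLogv T.K)).StarPacket v))
      (act : ℤ → ∀ v : (thetaIndex (pilotDataOfK T.D T.K)).V, v ∈ (thetaIndex (pilotDataOfK T.D T.K)).Vbad →
        (logShellsDH (pilotDataOfK T.D T.K) (analyticLogv T.K)).StarPacket v →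
          Module.End ℚ ((logShellsDH (pilotDataOfK T.D T.K) (analyticLogv T.K)).StarPacket v))
      (Mmod : ℤ → ∀ j : (thetaIndex (pilotDataOfK T.D T.K)).LabelStar, Set ((logShellsDH (pilotDataOfK T.D T.K) (analyticLogv T.K)).GlobalPacket j.1))
      (region : ℤ → ∀ j : (thetaIndex (pilotDataOfK T.D T.K)).LabelStar, FinDivisor M → ∀ vQ : (thetaIndex (pilotDataOfK T.D T.K)).VQ,
        Set ((logShellsDH (pilotDataOfK T.D T.K) (analyticLogv T.K)).Packet j.1 vQ))
      (frobAdm : ℤ → ℤ → ∀ (j : (thetaIndex (pilotDataOfK T.D T.K)).Label) (vQ : (thetaIndex (pilotDataOfK T.D T.K)).VQ),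
        Set ((logShellsDH (pilotDataOfK T.D T.K) (analyticLogv T.K)).Packet j vQ) → Prop)
      (frobLogvol : ℤ → ℤ → ∀ (j : (thetaIndex (pilotDataOfK T.D T.K)).Label) (vQ : (thetaIndex (pilotDataOfK T.D T.K)).VQ),
        Set ((logShellsDH (pilotDataOfK T.D T.K) (analyticLogv T.K)).Packet j vQ) → ℝ)
      (frobΨ : ℤ → ℤ → ∀ v : (thetaIndex (pilotDataOfK T.D T.K)).V, v ∈ (thetaIndex (pilotDataOfK T.D T.K)).Vbad →
        Set ((logShellsDH (pilotDataOfK T.D T.K) (analyticLogv T.K)).StarPacket v))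
      (frobMmod : ℤ → ℤ → ∀ j : (thetaIndex (pilotDataOfK T.D T.K)).LabelStar, Set ((logShellsDH (pilotDataOfK T.D T.K) (analyticLogv T.K)).GlobalPacket j.1))
      (unitImage : ℤ → ℤ → ℕ → ∀ (j : (thetaIndex (pilotDataOfK T.D T.K)).Label) (vQ : (thetaIndex (pilotDataOfK T.D T.K)).VQ),
        Set ((logShellsDH (pilotDataOfK T.D T.K) (analyticLogv T.K)).Packet j vQ))
      (ballImage : ℤ → ℤ → ∀ (j : (thetaIndex (pilotDataOfK T.D T.K)).Label) (vQ : (thetaIndex (pilotDataOfK T.D T.K)).VQ),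
        Set ((logShellsDH (pilotDataOfK T.D T.K) (analyticLogv T.K)).Packet j vQ))
      (thetaDiv : ℤ → ℤ → LgpDivisor M (thetaIndex (pilotDataOfK T.D T.K)).lstar)
      (n : ℤ) {HT : Type} {LogLink : HT → HT → Type} {IsFull : ∀ {s t : HT}, LogLink s t → Prop}
      (lat : LGPGaussianLogThetaLattice LogLink IsFull)
      {Frd : Type} {IsoF : Frd → Frd → Type} {Ob : Frd → Type} {realify : Frd → Frd} {Strip : Type}
      {IsoS : Strip → Strip → Type} {Mv : ∀ v : (thetaIndex (pilotDataOfK T.D T.K)).V, v ∈ (thetaIndex (pilotDataOfK T.D T.K)).Vbad → Type}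
      [∀ v h, Monoid (Mv v h)]
      (sig : GlobalLGPFrobenioidSignature (thetaIndex (pilotDataOfK T.D T.K)).lstar (thetaIndex (pilotDataOfK T.D T.K)).V
        (· ∈ (thetaIndex (pilotDataOfK T.D T.K)).Vbad) Frd IsoF Ob realify Strip IsoS Mv)
      (split : SplittingMonoids Mv) {ObΔ : Type} {N : ∀ v : (thetaIndex (pilotDataOfK T.D T.K)).V, v ∈ (thetaIndex (pilotDataOfK T.D T.K)).Vbad → Type}
      [∀ v h, Monoid (N v h)] (qData : QPilotData ObΔ N)
      (qK : ∀ v : (thetaIndex (pilotDataOfK T.D T.K)).V, v ∈ (thetaIndex (pilotDataOfK T.D T.K)).Vbad →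
        Set ((logShellsDH (pilotDataOfK T.D T.K) (analyticLogv T.K)).StarPacket v)),
      ¬ Cor312Vol.PilotKummerCompatHull
          (LatticeSituation.ofShells (logShellsDH (pilotDataOfK T.D T.K) (analyticLogv T.K)) M archPk archSub
            (summandPiecesPr (pilotDataOfK T.D T.K) (logvAnalytic_analyticLogv (F := T.K))).Adm
            (summandPiecesPr (pilotDataOfK T.D T.K) (logvAnalytic_analyticLogv (F := T.K))).logvol Ψ act Mmod region frobAdm frobLogvol frobΨ
            frobMmod unitImage ballImage thetaDiv)
          (settingPrVolSharp (pilotDataOfK T.D T.K) (logvAnalytic_analyticLogv (F := T.K)) M archPk archSub Ψ act Mmod region n lat sig split qData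
            (exists_realising_qIdeles_pilotDataOfK T.D).choose (exists_realising_thetaIdeles_pilotDataOfK T.D).choose
            (exists_realising_qIdeles_pilotDataOfK T.D).choose_spec.1 (exists_realising_qIdeles_pilotDataOfK T.D).choose_spec.2.1)
          (fun _ => Cor312.Setting.qRegion
            (settingPrVolSharp (pilotDataOfK T.D T.K) (logvAnalytic_analyticLogv (F := T.K)) M archPk archSub Ψ act Mmod region n lat sig split qData
              (exists_realising_qIdeles_pilotDataOfK T.D).choose (exists_realising_thetaIdeles_pilotDataOfK T.D).choose
              (exists_realising_qIdeles_pilotDataOfK T.D).choose_spec.1 (exists_realising_qIdeles_pilotDataOfK T.D).choose_spec.2.1)) qK := by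
  classical
  letI := T.instFieldF; letI := T.instNumberFieldF; letI := T.instAlgebraF; letI := T.instFieldK
  letI := T.instNumberFieldK; letI := T.instAlgebraK; letI := T.instFieldFbar; letI := T.instAlgebraFbar
  letI := T.instAlgebraKFbar; letI := T.instIsElliptic
  intro M _ _ archPk archSub Ψ act Mmod region frobAdm frobLogvol frobΨ frobMmod unitImage ballImage thetaDiv n HT LogLink IsFull lat
    Frd IsoF Ob realify Strip IsoS Mv _ sig split ObΔ N _ qData qK
  obtain ⟨i, x₀, -, -, hdeep⟩ := GenuineK.exists_deep_place_lamSeven_of_pow_lt hk hl h11 hpow T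
  exact GenuineK.not_pilotKummerCompatHull_chosen_of_explicit_depth T.D M archPk archSub Ψ act Mmod region frobAdm frobLogvol frobΨ
    frobMmod unitImage ballImage thetaDiv n lat sig split qData qK ⟨7, by norm_num⟩ i x₀ hdeep

/-- **THE TAME TABLE — S_H fails at every genuine datum over `λ_k` for `(l, k)` with `l = 11 ∧ k ≥ 35`, `l = 13 ∧ k ≥ 34`, or
`l ∈ {17, 19, 23, 29, 31, 37} ∧ k ≥ 33`** (the integer test of §2 evaluated in §3; each threshold is the LEAST `k` passing the test with this
constant). One theorem for the R-W table rows `HEX:k:l` in these ranges (verdict REFUTED-dab; deciding decl = this). [claim: Mochizuki2012, status: disputed] -/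
theorem GenuineK.not_pilotKummerCompatHull_lamSeven_tameTable {k l : ℕ}
    (hkl : (l = 11 ∧ 35 ≤ k) ∨ (l = 13 ∧ 34 ≤ k) ∨ ((l = 17 ∨ l = 19 ∨ l = 23 ∨ l = 29 ∨ l = 31 ∨ l = 37) ∧ 33 ≤ k))
    (T : Cor22.ThetaVolumeDatumAt (ratPoint ((2 : ℚ)⁻¹ + 2 / 7 ^ k)) l) :
    letI := T.instFieldF; letI := T.instNumberFieldF; letI := T.instAlgebraF; letI := T.instFieldK
    letI := T.instNumberFieldK; letI := T.instAlgebraK; letI := T.instFieldFbar; letI := T.instAlgebraFbar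
    letI := T.instAlgebraKFbar; letI := T.instIsElliptic
    ∀ (M : Type) [Field M] [NumberField M]
      (archPk : ∀ (j : (thetaIndex (pilotDataOfK T.D T.K)).Label) (vQ : (thetaIndex (pilotDataOfK T.D T.K)).VQ),
        Set ((logShellsDH (pilotDataOfK T.D T.K) (analyticLogv T.K)).Packet j vQ))
      (archSub : ∀ (j : (thetaIndex (pilotDataOfK T.D T.K)).Label) (v : (thetaIndex (pilotDataOfK T.D T.K)).V),
        Set ((logShellsDH (pilotDataOfK T.D T.K) (analyticLogv T.K)).Packet j ((thetaIndex (pilotDataOfK T.D T.K)).over v)))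
      (Ψ : ℤ → ∀ v : (thetaIndex (pilotDataOfK T.D T.K)).V, v ∈ (thetaIndex (pilotDataOfK T.D T.K)).Vbad →
        Set ((logShellsDH (pilotDataOfK T.D T.K) (analyticLogv T.K)).StarPacket v))
      (act : ℤ → ∀ v : (thetaIndex (pilotDataOfK T.D T.K)).V, v ∈ (thetaIndex (pilotDataOfK T.D T.K)).Vbad →
        (logShellsDH (pilotDataOfK T.D T.K) (analyticLogv T.K)).StarPacket v →
          Module.End ℚ ((logShellsDH (pilotDataOfK T.D T.K) (analyticLogv T.K)).StarPacket v))
      (Mmod : ℤ → ∀ j : (thetaIndex (pilotDataOfK T.D T.K)).LabelStar, Set ((logShellsDH (pilotDataOfK T.D T.K) (analyticLogv T.K)).GlobalPacket j.1))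
      (region : ℤ → ∀ j : (thetaIndex (pilotDataOfK T.D T.K)).LabelStar, FinDivisor M → ∀ vQ : (thetaIndex (pilotDataOfK T.D T.K)).VQ,
        Set ((logShellsDH (pilotDataOfK T.D T.K) (analyticLogv T.K)).Packet j.1 vQ))
      (frobAdm : ℤ → ℤ → ∀ (j : (thetaIndex (pilotDataOfK T.D T.K)).Label) (vQ : (thetaIndex (pilotDataOfK T.D T.K)).VQ),
        Set ((logShellsDH (pilotDataOfK T.D T.K) (analyticLogv T.K)).Packet j vQ) → Prop)
      (frobLogvol : ℤ → ℤ → ∀ (j : (thetaIndex (pilotDataOfK T.D T.K)).Label) (vQ : (thetaIndex (pilotDataOfK T.D T.K)).VQ),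
        Set ((logShellsDH (pilotDataOfK T.D T.K) (analyticLogv T.K)).Packet j vQ) → ℝ)
      (frobΨ : ℤ → ℤ → ∀ v : (thetaIndex (pilotDataOfK T.D T.K)).V, v ∈ (thetaIndex (pilotDataOfK T.D T.K)).Vbad →
        Set ((logShellsDH (pilotDataOfK T.D T.K) (analyticLogv T.K)).StarPacket v))
      (frobMmod : ℤ → ℤ → ∀ j : (thetaIndex (pilotDataOfK T.D T.K)).LabelStar, Set ((logShellsDH (pilotDataOfK T.D T.K) (analyticLogv T.K)).GlobalPacket j.1))
      (unitImage : ℤ → ℤ → ℕ → ∀ (j : (thetaIndex (pilotDataOfK T.D T.K)).Label) (vQ : (thetaIndex (pilotDataOfK T.D T.K)).VQ),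
        Set ((logShellsDH (pilotDataOfK T.D T.K) (analyticLogv T.K)).Packet j vQ))
      (ballImage : ℤ → ℤ → ∀ (j : (thetaIndex (pilotDataOfK T.D T.K)).Label) (vQ : (thetaIndex (pilotDataOfK T.D T.K)).VQ),
        Set ((logShellsDH (pilotDataOfK T.D T.K) (analyticLogv T.K)).Packet j vQ))
      (thetaDiv : ℤ → ℤ → LgpDivisor M (thetaIndex (pilotDataOfK T.D T.K)).lstar)
      (n : ℤ) {HT : Type} {LogLink : HT → HT → Type} {IsFull : ∀ {s t : HT}, LogLink s t → Prop}
      (lat : LGPGaussianLogThetaLattice LogLink IsFull)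
      {Frd : Type} {IsoF : Frd → Frd → Type} {Ob : Frd → Type} {realify : Frd → Frd} {Strip : Type}
      {IsoS : Strip → Strip → Type} {Mv : ∀ v : (thetaIndex (pilotDataOfK T.D T.K)).V, v ∈ (thetaIndex (pilotDataOfK T.D T.K)).Vbad → Type}
      [∀ v h, Monoid (Mv v h)]
      (sig : GlobalLGPFrobenioidSignature (thetaIndex (pilotDataOfK T.D T.K)).lstar (thetaIndex (pilotDataOfK T.D T.K)).V
        (· ∈ (thetaIndex (pilotDataOfK T.D T.K)).Vbad) Frd IsoF Ob realify Strip IsoS Mv)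
      (split : SplittingMonoids Mv) {ObΔ : Type} {N : ∀ v : (thetaIndex (pilotDataOfK T.D T.K)).V, v ∈ (thetaIndex (pilotDataOfK T.D T.K)).Vbad → Type}
      [∀ v h, Monoid (N v h)] (qData : QPilotData ObΔ N)
      (qK : ∀ v : (thetaIndex (pilotDataOfK T.D T.K)).V, v ∈ (thetaIndex (pilotDataOfK T.D T.K)).Vbad →
        Set ((logShellsDH (pilotDataOfK T.D T.K) (analyticLogv T.K)).StarPacket v)),
      ¬ Cor312Vol.PilotKummerCompatHull
          (LatticeSituation.ofShells (logShellsDH (pilotDataOfK T.D T.K) (analyticLogv T.K)) M archPk archSub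
            (summandPiecesPr (pilotDataOfK T.D T.K) (logvAnalytic_analyticLogv (F := T.K))).Adm
            (summandPiecesPr (pilotDataOfK T.D T.K) (logvAnalytic_analyticLogv (F := T.K))).logvol Ψ act Mmod region frobAdm frobLogvol frobΨ
            frobMmod unitImage ballImage thetaDiv)
          (settingPrVolSharp (pilotDataOfK T.D T.K) (logvAnalytic_analyticLogv (F := T.K)) M archPk archSub Ψ act Mmod region n lat sig split qData
            (exists_realising_qIdeles_pilotDataOfK T.D).choose (exists_realising_thetaIdeles_pilotDataOfK T.D).choose
            (exists_realising_qIdeles_pilotDataOfK T.D).choose_spec.1 (exists_realising_qIdeles_pilotDataOfK T.D).choose_spec.2.1)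
          (fun _ => Cor312.Setting.qRegion
            (settingPrVolSharp (pilotDataOfK T.D T.K) (logvAnalytic_analyticLogv (F := T.K)) M archPk archSub Ψ act Mmod region n lat sig split qData
              (exists_realising_qIdeles_pilotDataOfK T.D).choose (exists_realising_thetaIdeles_pilotDataOfK T.D).choose
              (exists_realising_qIdeles_pilotDataOfK T.D).choose_spec.1 (exists_realising_qIdeles_pilotDataOfK T.D).choose_spec.2.1)) qK := by
  rcases hkl with ⟨rfl, hk⟩ | ⟨rfl, hk⟩ | ⟨hl, hk⟩
  · exact GenuineK.not_pilotKummerCompatHull_lamSeven_of_pow_lt (by omega) (by norm_num) le_rfl (Hex.test_eleven hk) T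
  · exact GenuineK.not_pilotKummerCompatHull_lamSeven_of_pow_lt (by omega) (by norm_num) (by norm_num) (Hex.test_thirteen hk) T
  · rcases hl with rfl | rfl | rfl | rfl | rfl | rfl
    · exact GenuineK.not_pilotKummerCompatHull_lamSeven_of_pow_lt (by omega) (by norm_num) (by norm_num) (Hex.test_seventeen hk) T
    · exact GenuineK.not_pilotKummerCompatHull_lamSeven_of_pow_lt (by omega) (by norm_num) (by norm_num) (Hex.test_nineteen hk) T
    · exact GenuineK.not_pilotKummerCompatHull_lamSeven_of_pow_lt (by omega) (by norm_num) (by norm_num) (Hex.test_twentythree hk) T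
    · exact GenuineK.not_pilotKummerCompatHull_lamSeven_of_pow_lt (by omega) (by norm_num) (by norm_num) (Hex.test_twentynine hk) T
    · exact GenuineK.not_pilotKummerCompatHull_lamSeven_of_pow_lt (by omega) (by norm_num) (by norm_num) (Hex.test_thirtyone hk) T
    · exact GenuineK.not_pilotKummerCompatHull_lamSeven_of_pow_lt (by omega) (by norm_num) (by norm_num) (Hex.test_thirtyseven hk) T

end Summit.ABC.IUTFork.Conditional

end
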